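import Summits.Ventures.PercRepro.S1TrianglePlusFreeC
import Summits.Ventures.PercRepro.S1TrianglePlusPlane

/-!
# PercRepro — two degree lemmas for the triangle count (p1, gen 20; towards LEMMA T⁺⁺⁺)

`t(x)` = the number of triangles through `x` (`ThmN.trianglesThrough`), `ν = |E| − r(E)`.
* **`ncard_triangles_le_succ_of_degree`** — under (C1) + (C2), if some non-loop `x` has `t(x) ≥ ν − 1` then
  `s₃ ≤ ν + 1` (the first two cases of LEMMA T⁺⁺ as a standalone statement: `t = ν` by T⁺'s cone lemma, `t = ν − 1`
  by the cone lemma with the plane bound or the free-cone lemma);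
* **`ncard_triangles_le_of_degree_le_one`** — under (C1), if every non-loop lies on at most one triangle, then
  `s₃ ≤ ν` (deletion induction: the triangles are pairwise disjoint);
* `triangles_delete_eq`, `trianglesThrough_delete_subset` — triangles and degrees under the deletion of a point.
Axioms: standard.
-/

open scoped Matroid

namespace PercRepro

namespace S1

open Set

variable {α : Type}

/-- The triangles of `M ＼ {x}` are the triangles of `M` avoiding `x`. -/
theorem triangles_delete_eq (M : Matroid α) (x : α) :
    ThmN.triangles (M ＼ {x}) = {C | C ∈ ThmN.triangles M ∧ x ∉ C} := by
  ext C
  simp only [ThmN.triangles, Set.mem_setOf_eq, _root_.Matroid.delete_isCircuit_iff,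
    Set.disjoint_singleton_right]
  tauto

/-- The degree of a point in `M ＼ {x}` is at most its degree in `M`. -/
theorem trianglesThrough_delete_subset (M : Matroid α) (x z : α) :
    ThmN.trianglesThrough (M ＼ {x}) z ⊆ ThmN.trianglesThrough M z := by
  intro C hC
  exact ⟨(_root_.Matroid.delete_isCircuit_iff.1 hC.1).1, hC.2.1, hC.2.2⟩

/-- **A point of degree `≥ ν − 1` bounds the count by `ν + 1`.** Under (C1) + (C2), if the non-loop `x` lies on at
least `d − 1` triangles (`|E| = r(E) + d`), then `M` has at most `d + 1` triangles. -/
theorem ncard_triangles_le_succ_of_degree (M : Matroid α) [M.Finite]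
    (hC1 : ∀ L ⊆ M.E, M.eRk L = 2 → L.ncard ≤ 3) (hC2 : ∀ P ⊆ M.E, M.eRk P ≤ 3 → P.ncard ≤ 6)
    {d : ℕ} (hd : M.E.encard = M.eRank + d) {x : α} (hx : M.IsNonloop x)
    (hdeg : d ≤ (ThmN.trianglesThrough M x).ncard + 1) :
    (ThmN.triangles M).ncard ≤ d + 1 := by
  classical
  set S := ThmN.triangles M with hS
  have hSfin : S.Finite :=
    M.ground_finite.finite_subsets.subset (fun C hC => hC.1.subset_ground)
  set S₁ := ThmN.trianglesThrough M x with hS₁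
  have hS₁fin : S₁.Finite := hSfin.subset (fun C hC => ⟨hC.1, hC.2.1⟩)
  set s := hS₁fin.toFinset with hsdef
  have hmem : ∀ C, C ∈ s ↔ C ∈ S₁ := fun C => Set.Finite.mem_toFinset hS₁fin
  have hs : ∀ C ∈ s, C ∈ S₁ := fun C hC => (hmem C).1 hC
  have hscard : s.card = S₁.ncard := by rw [hsdef, ← Set.ncard_eq_toFinset_card _ hS₁fin]
  have h1 : S₁.ncard ≤ d := ThmN.ncard_trianglesThrough_le M hC1 hx hd
  set S₂ := {T | T ∈ ThmN.triangles M ∧ x ∉ T} with hS₂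
  have hsplit : S ⊆ S₁ ∪ S₂ := by
    intro C hC
    by_cases h : x ∈ C
    · exact Or.inl ⟨hC.1, hC.2, h⟩
    · exact Or.inr ⟨hC, h⟩
  have hS₂fin : S₂.Finite := hSfin.subset (fun C hC => hC.1)
  have h3 : S.ncard ≤ S₁.ncard + S₂.ncard := by
    calc S.ncard ≤ (S₁ ∪ S₂).ncard := ncard_le_ncard hsplit (hS₁fin.union hS₂fin)
      _ ≤ S₁.ncard + S₂.ncard := ncard_union_le _ _
  -- CASE 1: `t = d`
  by_cases hcone : S₁.ncard = d
  · have hS₁S : S = S₁ := by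
      apply Set.Subset.antisymm
      · intro C hC
        exact ⟨hC.1, hC.2,
          mem_of_mem_triangles_of_ncard_trianglesThrough_eq M hC1 hx hd hcone hC⟩
      · intro C hC
        exact ⟨hC.1, hC.2.1⟩
    rw [hS₁S, hcone]
    omega
  -- CASE 2: `t + 1 = d`
  have hcone' : S₁.ncard + 1 = d := by omega
  set U : Set α := {x} ∪ ⋃ C ∈ s, C with hU
  have hUE : U ⊆ M.E := by
    intro z hz
    rcases hz with hz | hz
    · rw [Set.mem_singleton_iff.1 hz]; exact hx.mem_ground
    · obtain ⟨C, hC, hzC⟩ := Set.mem_iUnion₂.1 hz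
      exact (hs C hC).1.subset_ground hzC
  have hUfin : U.Finite := M.ground_finite.subset hUE
  obtain ⟨hrU, hcU⟩ := ThmN.eRk_le_and_ncard_eq_of_triangles M hC1 hx s hs
  have hcU' : U.ncard = 1 + 2 * s.card := hcU
  have hrE : M.eRank ≤ M.eRk U + (M.E \ U).encard := by
    have := M.eRk_union_le_eRk_add_encard U (M.E \ U)
    rwa [Set.union_sdiff_cancel hUE, M.eRk_ground] at this
  have hcard : M.E.ncard = U.ncard + (M.E \ U).ncard := by
    conv_lhs => rw [← Set.union_sdiff_cancel hUE]
    exact Set.ncard_union_eq Set.disjoint_sdiff_right hUfin (M.ground_finite.sdiff)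
  have hneU : M.eRk U ≠ ⊤ := ((M.eRk_le_encard _).trans_lt hUfin.encard_lt_top).ne
  obtain ⟨a, ha⟩ := ENat.ne_top_iff_exists.1 hneU
  have hneR : M.eRank ≠ ⊤ :=
    (M.eRank_le_encard_ground.trans_lt M.ground_finite.encard_lt_top).ne
  obtain ⟨r, hr'⟩ := ENat.ne_top_iff_exists.1 hneR
  have e1 : r ≤ a + (M.E \ U).ncard := by
    rw [← ha, ← hr', ← (M.ground_finite.sdiff (t := U)).cast_ncard_eq] at hrE
    exact_mod_cast hrE
  have e2 : a ≤ 1 + s.card := by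
    rw [← ha] at hrU
    exact_mod_cast hrU
  have e3 : M.E.ncard = r + d := by
    rw [← hr', ← M.ground_finite.cast_ncard_eq] at hd
    exact_mod_cast hd
  have hsd : s.card + 1 = d := by rw [hscard]; exact hcone'
  by_cases hafree : a = 1 + s.card
  · -- the free cone with one unit of nullity outside: at most two triangles avoid `x`
    have hfree : M.eRk U = ((1 + s.card : ℕ) : ℕ∞) := by rw [← ha, hafree]
    have hd' : M.E.encard = M.eRank + ((s.card + 1 : ℕ) : ℕ∞) := by rw [hd, hsd]
    have h2 : S₂.ncard ≤ 2 := ncard_triangles_not_mem_le_two M hC1 hx s hmem hfree hd'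
    omega
  · -- `r(U) = t`: the cone carries all the nullity, every triangle contains `x`
    have hfull : M.eRk U + (M.E \ U).encard ≤ M.eRank := by
      rw [← ha, ← hr', ← (M.ground_finite.sdiff (t := U)).cast_ncard_eq]
      have : a + (M.E \ U).ncard ≤ r := by omega
      exact_mod_cast this
    have hS₁S : S = S₁ := by
      apply Set.Subset.antisymm
      · intro C hC
        exact ⟨hC.1, hC.2,
          mem_of_mem_triangles_of_eRk_add_encard_le M hC1 hC2 hx s hmem hfull hC⟩
      · intro C hC
        exact ⟨hC.1, hC.2.1⟩
    rw [hS₁S]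
    omega

/-- **Pairwise disjoint triangles number at most the nullity.** Under (C1), if every non-loop lies on at most one
triangle, then `#(triangles M) ≤ d` where `|E| = r(E) + d`. -/
theorem ncard_triangles_le_of_degree_le_one (M : Matroid α) [M.Finite]
    (hC1 : ∀ L ⊆ M.E, M.eRk L = 2 → L.ncard ≤ 3) {d : ℕ} (hd : M.E.encard = M.eRank + d)
    (hdeg : ∀ x, M.IsNonloop x → (ThmN.trianglesThrough M x).ncard ≤ 1) :
    (ThmN.triangles M).ncard ≤ d := by
  suffices H : ∀ n : ℕ, ∀ (M : Matroid α) [M.Finite], M.E.ncard = n →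
      (∀ L ⊆ M.E, M.eRk L = 2 → L.ncard ≤ 3) →
      (∀ x, M.IsNonloop x → (ThmN.trianglesThrough M x).ncard ≤ 1) →
      ∀ d : ℕ, M.E.encard = M.eRank + d → (ThmN.triangles M).ncard ≤ d from
    H _ M rfl hC1 hdeg d hd
  intro n
  induction n using Nat.strong_induction_on with
  | _ n ih =>
  intro M _ hn hC1 hdeg d hd
  classical
  set S := ThmN.triangles M with hS
  have hSfin : S.Finite :=
    M.ground_finite.finite_subsets.subset (fun C hC => hC.1.subset_ground)
  by_cases hSe : S = ∅
  · rw [hSe, ncard_empty]; exact Nat.zero_le _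
  obtain ⟨C₀, hC₀⟩ := nonempty_iff_ne_empty.2 hSe
  obtain ⟨e, heC₀⟩ := hC₀.1.nonempty
  have heE : e ∈ M.E := hC₀.1.subset_ground heC₀
  have hx : M.IsNonloop e := by
    refine _root_.Matroid.isNonloop_of_not_isLoop heE ?_
    intro hloop
    have hC₀e : C₀ = {e} := hloop.eq_of_isCircuit_mem hC₀.1 heC₀
    have := hC₀.2
    rw [hC₀e, ncard_singleton] at this
    omega
  set S₁ := ThmN.trianglesThrough M e with hS₁
  set S₂ := {C | M.IsCircuit C ∧ C.ncard = 3 ∧ e ∉ C} with hS₂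
  have hsplit : S ⊆ S₁ ∪ S₂ := by
    intro C hC
    by_cases h : e ∈ C
    · exact Or.inl ⟨hC.1, hC.2, h⟩
    · exact Or.inr ⟨hC.1, hC.2, h⟩
  have hS₁fin : S₁.Finite := hSfin.subset (fun C hC => ⟨hC.1, hC.2.1⟩)
  have hS₂fin : S₂.Finite := hSfin.subset (fun C hC => ⟨hC.1, hC.2.1⟩)
  have h1 : S₁.ncard ≤ 1 := hdeg e hx
  have h3 : S.ncard ≤ S₁.ncard + S₂.ncard := by
    calc S.ncard ≤ (S₁ ∪ S₂).ncard := ncard_le_ncard hsplit (hS₁fin.union hS₂fin)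
      _ ≤ S₁.ncard + S₂.ncard := ncard_union_le _ _
  -- delete `e`
  have hne : ¬ M.IsColoop e := hC₀.1.not_isColoop_of_mem heC₀
  have hν : M✶.eRank = (d : ℕ∞) := by
    have h := _root_.Matroid.eRank_add_eRank_dual M
    rw [hd] at h
    exact WithTop.add_left_cancel (PercRepro.Matroid.eRank_ne_top_of_finite M) h
  have hdel := PercRepro.Matroid.dual_eRank_delete_singleton_add_one heE hne
  rw [hν] at hdel
  have hfin' : (M ＼ {e})✶.eRank ≠ ⊤ := by
    intro h
    rw [h] at hdel
    exact absurd hdel (by simp)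
  obtain ⟨d', hd'⟩ := ENat.ne_top_iff_exists.1 hfin'
  have hdd' : d = d' + 1 := by
    rw [← hd'] at hdel
    exact_mod_cast hdel.symm
  have hd'enc : (M ＼ {e}).E.encard = (M ＼ {e}).eRank + d' := by
    have h := _root_.Matroid.eRank_add_eRank_dual (M ＼ {e})
    rw [← hd'] at h
    exact h.symm
  have hdelE : (M ＼ {e}).E.ncard < n := by
    rw [_root_.Matroid.delete_ground, ← hn, ← ncard_sdiff_singleton_add_one heE M.ground_finite]
    omega
  have hC1' : ∀ L ⊆ (M ＼ {e}).E, (M ＼ {e}).eRk L = 2 → L.ncard ≤ 3 := by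
    intro L hL hr
    rw [_root_.Matroid.delete_ground] at hL
    rw [delete_singleton_eRk_eq hL] at hr
    exact hC1 L (hL.trans sdiff_subset) hr
  -- the degrees in `M ＼ {e}` are at most those in `M`
  have hdeg' : ∀ x, (M ＼ {e}).IsNonloop x → (ThmN.trianglesThrough (M ＼ {e}) x).ncard ≤ 1 := by
    intro x hx'
    have hxM : M.IsNonloop x := hx'.of_delete
    have hsub : ThmN.trianglesThrough (M ＼ {e}) x ⊆ ThmN.trianglesThrough M x := by
      intro C hC
      exact ⟨(_root_.Matroid.delete_isCircuit_iff.1 hC.1).1, hC.2.1, hC.2.2⟩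
    have hfin : (ThmN.trianglesThrough M x).Finite :=
      M.ground_finite.finite_subsets.subset (fun C hC => hC.1.subset_ground)
    exact (ncard_le_ncard hsub hfin).trans (hdeg x hxM)
  have h2 : S₂.ncard ≤ d' := by
    have hsub : S₂ ⊆ ThmN.triangles (M ＼ {e}) := by
      intro C hC
      exact ⟨_root_.Matroid.delete_isCircuit_iff.2 ⟨hC.1, disjoint_singleton_right.2 hC.2.2⟩, hC.2.1⟩
    have hle : S₂.ncard ≤ (ThmN.triangles (M ＼ {e})).ncard :=
      ncard_le_ncard hsub
        ((M ＼ {e}).ground_finite.finite_subsets.subset (fun C hC => hC.1.subset_ground))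
    exact hle.trans (ih _ hdelE (M ＼ {e}) rfl hC1' hdeg' d' hd'enc)
  omega

end S1

end PercRepro
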